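import Literature.GroupTheory.CombinatorialGroupTheory.AmalgamFreeSubgroups
import Mathlib.GroupTheory.OrderOfElement
import HarnessLib

/-!
# Torsion-free subgroups of amalgams of torsion groups are free

Topic `Literature/GroupTheory/CombinatorialGroupTheory`; a corollary file of `AmalgamFreeSubgroups.lean`
(theorems only).  If every factor `G i` of an amalgamated free product `∗_H G i` (Mathlib's
`Monoid.PushoutI φ`, injective `φ i : H →* G i`, nonempty index set) is a TORSION group — in particular if
every `G i` is finite — then every subgroup `K ≤ ∗_H G i` without non-trivial elements of finite order is a
FREE group: a conjugate of `K` meets a factor in a subgroup that is at once torsion and torsion-free, hence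
trivially, so `isFreeGroup_of_disjoint_conjugates` applies.  Classical instance: the torsion-free subgroups
of `C₂ ∗ C₃ ≅ PSL₂(ℤ)` are free.

This is the amalgam case of D. E. Cohen, *Combinatorial Group Theory: a topological approach*, LMS Student
Texts 14 (1989), Ch. 8, Thm. 55 with its Corollary ("A torsion-free group with a free subgroup of finite
index is free") and Prop. 56, p. 240 — here obtained directly from the free-action-groupoid theorem rather
than via a free subgroup of finite index, so no finiteness of the index set or of `H` is needed.
[cite: CohenCGT1989, Ch. 8 Thm. 55 Cor. p.240]

Written for the abc-iut cell's F-2732 brick programme as a by-product of brick «finite amalgams are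
virtually free»; pure group theory, no new named facts.
-/

namespace Literature.GroupTheory.CombinatorialGroupTheory

open Monoid Function

universe u

variable {ι : Type u} {G : ι → Type u} [∀ i, Group (G i)] {H : Type u} [Group H] {φ : ∀ i, H →* G i}

/-- A conjugate `γ⁻¹ x γ` of an element of finite order has finite order.
[cite: CohenCGT1989, Ch. 8 Thm. 55 Cor. p.240] -/
theorem isOfFinOrder_conj_of_isOfFinOrder {Γ : Type u} [Group Γ] {x : Γ} (γ : Γ) (hx : IsOfFinOrder x) :
    IsOfFinOrder (γ⁻¹ * x * γ) := by
  have h := (MulAut.conj γ⁻¹).toMonoidHom.isOfFinOrder hx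
  simpa [MulAut.conj_apply, mul_assoc] using h

/-- **Torsion-free subgroups of an amalgam of torsion groups are free.**  For injective
`φ i : H →* G i` over a nonempty index set with every `G i` a torsion group, a subgroup `K ≤ ∗_H G i` in
which only `1` has finite order is a free group. [cite: CohenCGT1989, Ch. 8 Thm. 55 Cor. p.240] -/
theorem isFreeGroup_of_torsion_factors [Nonempty ι] (hφ : ∀ i, Injective (φ i))
    (hG : ∀ (i : ι) (g : G i), IsOfFinOrder g) (K : Subgroup (PushoutI φ))
    (hK : ∀ k ∈ K, IsOfFinOrder k → k = 1) : IsFreeGroup K := by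
  refine isFreeGroup_of_disjoint_conjugates' hφ K fun i g γ hmem => ?_
  have hfin : IsOfFinOrder (γ⁻¹ * PushoutI.of (φ := φ) i g * γ) :=
    isOfFinOrder_conj_of_isOfFinOrder γ ((PushoutI.of (φ := φ) i).isOfFinOrder (hG i g))
  have h1 : γ⁻¹ * PushoutI.of (φ := φ) i g * γ = 1 := hK _ hmem hfin
  have h2 : PushoutI.of (φ := φ) i g = 1 := by
    have := congrArg (fun x => γ * x * γ⁻¹) h1
    simpa [mul_assoc] using this
  exact PushoutI.of_injective hφ i (by rw [h2, map_one])

/-- **Torsion-free subgroups of an amalgam of finite groups are free** (e.g. the torsion-free subgroups of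
`C₂ ∗ C₃`). [cite: CohenCGT1989, Ch. 8 Thm. 55 Cor. p.240] -/
theorem isFreeGroup_of_finite_factors [Nonempty ι] [∀ i, Finite (G i)] (hφ : ∀ i, Injective (φ i))
    (K : Subgroup (PushoutI φ)) (hK : ∀ k ∈ K, IsOfFinOrder k → k = 1) : IsFreeGroup K :=
  isFreeGroup_of_torsion_factors hφ (fun _ g => isOfFinOrder_of_finite g) K hK

/-- Subgroup form of the hypothesis: `K` is free as soon as its elements of finite order (computed inside
`K`) are trivial. [cite: CohenCGT1989, Ch. 8 Thm. 55 Cor. p.240] -/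
theorem isFreeGroup_of_finite_factors' [Nonempty ι] [∀ i, Finite (G i)] (hφ : ∀ i, Injective (φ i))
    (K : Subgroup (PushoutI φ)) (hK : ∀ k : K, IsOfFinOrder k → k = 1) : IsFreeGroup K :=
  isFreeGroup_of_finite_factors hφ K fun k hk hfin => by
    have h := hK ⟨k, hk⟩ (Submonoid.isOfFinOrder_coe (H := K.toSubmonoid) (x := ⟨k, hk⟩) |>.mp hfin)
    simpa using congrArg Subtype.val h

end Literature.GroupTheory.CombinatorialGroupTheory
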